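/-
Copyright (c) 2026 the pub-hodgecm-mathlib formalisation cell (harness21).  Prover seat hodgecm-mathlib-LH4-p11 (g9), req620 Track A «(D-RAM) FOUR-FRAME» squad, helper lane on
h413 = stmt-HodgeConjecture-24833 (count-neutral).  β-BOARD v1 (sub-dealer LH4-p05 (g8)) ROW R6 «SPECIAL κ-CLASSES» — THE LATTICE INPUT in G₃ currency (tower 3 special): the foot
twin of LH7-p06 (g0)'s R5b head `twoSlotLabel_latt_G3`, adapted from it and from this seat's ★ p861330.  2026-09-04.
-/
import Summits.HodgeConjecture.HodgeConjecture.Theorems.F0P3cDyRamTwoSlotLabelRead              -- ★ (LH4-p13 (g8), (L-lab-20a)): `valueClassLabel_latt_hnf_iff_normSign`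
import Summits.HodgeConjecture.HodgeConjecture.Theorems.F0P3cDyRamDiagonalGluedStratumG3        -- ★ p861251 (LH7-p06 (g0)): `v_polarisation_latt_G3`, `v_gram_cancel_latt_G3_eq∕_le`, `v_sub_le_of_mem_fixedUnitStabilizer_latt_G3`, …
import Summits.HodgeConjecture.HodgeConjecture.Theorems.F0P3cDyRamDiagonalOrbitFibreTransport     -- ★ (LH4-p11 (g2)): `fibre_isCoset_zero`
import Summits.HodgeConjecture.HodgeConjecture.Theorems.F0P3cDyRamStageOneBDefs                   -- ★ DEFS №5: `mcOfRecord`; brings `mstarOfRecord`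
import Literature.NumberTheory.LocalFields.ValuedCompleteIsAdicComplete                           -- ★ `isAdicComplete_valuedInteger_of_completeSpace`
import HarnessLib

/-!
# Crux `H413`, line LH4 «(D-RAM) FOUR-FRAME» — (β-BAL) Stage B, β-BOARD ROW R6 «SPECIAL κ-CLASSES», THE LATTICE INPUT (tower 3): on the G₃ normal form AT THE FOOT
# `2ρ + ℓ₀ = n₁` the value-class label on the polarisation fibre is `ω` of the SAME explicit two-slot linear form as on the tube — with the rôles of leading term and twist exchanged

Cell `hodgecm-mathlib` (D-0151), FLOOR 0, crux item H413 = `stmt-HodgeConjecture-24833`, route `HCCMUnconditional`; squad F0∕P3c∕LH4.  THEOREMS ONLY (no `def`, no instance, no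
notation, no `sorry`, default heartbeats); ★-only imports; lane `--supports stmt-HodgeConjecture-24833 --as helper` (count-neutral); pays NO row, states NO law.
WHAT.  The κ-CLASSES of the special tower `X* = 3` (`n₁ = n₂ = m < n₃`) are the strata `G₃(ρ, s) = (2ρ+s, 2ρ+s, 2ρ)` with `2ρ + ℓ₀ = m` and `2 ≤ s ≤ s_g − 2` (LH4-cdis1 (g0)
KAPPA-CLASS-RULE v1 9469d3b1; sub-dealer ruling 15:27:19Z).  They sit exactly ONE STEP BELOW the capped tube `2ρ + ℓ₀ + 1 ≤ n₁` of LH7-p06 (g0)'s R5b head `twoSlotLabel_latt_G3`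
and OFF the read `2ρ + s + ℓ₀ = n₃`.  This file proves that the label read there has the SAME LETTER:
* §1 HEAD **`twoSlotLabel_latt_G3_foot`** — on `M₀ = latt (1 0 0; x ϖ^{ρ+s} 0; y z ϖ^{2ρ})` (`|x| = |y| = 1`, `|z| = |ϖ|^ρ`) with polarisation `D`, AT THE FOOT `2k₁ + ℓ₀ = n₁ = 2ρ + ℓ₀`
  and BELOW THE READ `2ρ + s < 2k₃` (`2k₃ + ℓ₀ = n₃`), tokens `e_C` of `β − α` at `k₃` and `e_B` of `β − 1` at `k₁`: for every `u ∈ S_F(M₀)`,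
  `valueClassLabel σ ϖ (α−1) (β−1) m* d M₀ (D·u) ↔ normSign σ (u₀·D₀(π₀^{k₁}e_B − π₀^{k₃}e_C) + u₁·D₁N(x)·π₀^{k₁}e_B) = 1`.
  MECHANISM (the exchange).  `A(u) = D₀u₀(α−1) + D₁u₁N(x)(β−1) = −D₀u₀(β−α) + B(u)·(β−1)`, `B(u) = u₀(D₀ + σxD₁x) + (u₁−u₀)D₁N(x)`.  On the tube the `e_C` term leads; at the foot
  `|B(u)| = exp 2ρ` EXACTLY (★ `v_gram_cancel_latt_G3_eq` + the stabiliser tube `|u₁−u₀| ≤ |ϖ|^{ρ+s}`), so `|B(u)(β−1)| = exp(2ρ − n₁) = |ϖ|^{ℓ₀}` IS the main term while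
  `|D₀u₀(β−α)| = exp(2ρ + s − n₃) = |ϖ|^{ℓ₀ + (s_g − s)}` is the twist (`s_g − s = 2k₃ − 2ρ − s ≥ 2`); the token errors are `|D₀π₀^{k₃}|·ϖ^{m*} ≤ ϖ^{m*}` and
  `|B(u)π₀^{k₁}|·ϖ^{m*} = ϖ^{m*}`; ★ p13's top-A read `valueClassLabel_latt_hnf_iff_normSign` at `(b, c) = (ρ+s, 2ρ)` concludes.
* §2 THE FOOT LETTERS an arithmetic hand needs (no label): **`v_leading_latt_G3_foot`** `|u₀D₀ + u₁D₁N(x)| = exp 2ρ` on `S_F(M₀)`; **`gram00_latt_G3`** the `(0,0)` Gram entry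
  `D₀ + σxD₁x = g₀₀ − σy·D₂·y` with `|g₀₀| ≤ 1`, `|σy·D₂·y| = exp 2ρ` (★ `gram_values` ∕ ★ `v_polarisation_latt_G3`) — whence `ω(D₀ + σxD₁x) = ω(−D₂)` at conductor depth, the door
  through which the OWN slot `o = 2` of the κ-class enters (`ω(D₂u₂)·λ(u)`); **`v_sub_two_zero_le_of_mem_fixedUnitStabilizer_latt_G3`** is ★ p861251's `|u₂ − u₀| ≤ |ϖ|^ρ`, re-exported
  in the letters of the class sum.
NOT HERE (the R6 head, LH4-p08 (g10)): the class-sign sum over a transversal of `S_F ∕ N(S̃ ∩ 𝒯)` (★ p860847), the depth-`ρ` character `ω(u₀u₂)·ω(1 + z₁(u))`, the stratum sum and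
the family total into ★ (T1) p861261's `restTarget`.
HONEST LABEL.  Count-neutral (`--supports`); nothing printed is asserted; R6, hRest, the table identity, (β-BAL), (β) `stub_law_cleanSgn`, T₊ remain OPEN; `HC_CM` is proved only
modulo the 7 printed citations (2 remaining named inputs: hLiu418 = `stmt-HodgeConjecture-24832`, h413 = `stmt-HodgeConjecture-24833`) until rung 0 closes.
References: [Kottwitz1986BaseChangeUnits] §1 pp. 240–241 · [Rogawski1990] §4.9 Prop. 4.9.1 (a)(b) p. 55, §4.10 p. 58 · [LanglandsShelstad1987] §3 · [Serre1979] Ch. V §3 Cor. 3 ·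
[Jacobowitz1962] §4, §7.
-/

set_option autoImplicit false

noncomputable section

namespace Summit.HodgeConjecture.HodgeConjecture.Cruxes.H413.F0P3cDyRamLabelledOddKappaClassLatticeG3

open Literature.NumberTheory.Automorphic Literature.NumberTheory.Automorphic.HermitianLattice
open Literature.NumberTheory.Automorphic.UnitaryLatticeTree Literature.NumberTheory.Automorphic.UnitaryThreeFourFrame
open Literature.NumberTheory.LocalFields Literature.NumberTheory.LocalFields.WildQuadraticDatum
open Summit.HodgeConjecture.HodgeConjecture.Cruxes.H413.F0P3cDyRamFourFramePieces
open Summit.HodgeConjecture.HodgeConjecture.Cruxes.H413.F0P3cDyRamFourFrameCensusDefs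
open Summit.HodgeConjecture.HodgeConjecture.Cruxes.H413.F0P3cDyRamStageOneBDefs (mcOfRecord)
open Summit.HodgeConjecture.HodgeConjecture.Cruxes.H413.F0P3cDyRamDiagonalTorusDefs
open Summit.HodgeConjecture.HodgeConjecture.Cruxes.H413.F0P3cDyRamDiagonalStrataDefs
open Summit.HodgeConjecture.HodgeConjecture.Cruxes.H413.F0P3cDyRamLabelledOddCountDefs
open Summit.HodgeConjecture.HodgeConjecture.Cruxes.H413.F0P3cDyRamDiagonalOrbitFibreTransport (fibre_isCoset_zero)
open Summit.HodgeConjecture.HodgeConjecture.Cruxes.H413.F0P3cDyRamDiagonalGluedStratumG3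
open Summit.HodgeConjecture.HodgeConjecture.Cruxes.H413.F0P3cDyRamDiagonalHNFDualFrameValues (gram_values)
open Summit.HodgeConjecture.HodgeConjecture.Cruxes.H413.F0P3cDyRamTwoSlotLabelRead (valueClassLabel_latt_hnf_iff_normSign)
open scoped Valued WithZero Matrix MatrixGroups

variable {K : Type} [Field K] [Valued K ℤᵐ⁰] [CompleteSpace K] {σ : K →+* K} {ϖ : K} {d t : ℕ} {α β : K} {N₀ n₁ n₂ n₃ : ℕ}

/-! ## §1  HEAD — the two-slot label on the G₃ normal form at the foot `2ρ + ℓ₀ = n₁` -/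

/-- **THE TWO-SLOT LABEL ON THE G₃ NORMAL FORM AT THE FOOT (R6 lattice input).**  `M₀ = latt (1 0 0; x ϖ^{ρ+s} 0; y z ϖ^{2ρ})` (`|x| = |y| = 1`, `|z| = |ϖ|^ρ`, `ρ, s ≥ 1`), element
datum at `N₀ ≥ mcOfRecord d`, `2 ≤ d`; `M₀` `T`-stable with polarisation `D` and on the clean shell of `X = diag(α−1, β−1, 0)`; FOOT `2k₁ + ℓ₀ = n₁ = 2ρ + ℓ₀`, and below the read:
`2k₃ + ℓ₀ = n₃` with `2ρ + s < 2k₃`; tokens `e_C` of `β − α` at `k₃`, `e_B` of `β − 1` at `k₁`.  Then for every `u ∈ S_F(M₀)`: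
`valueClassLabel σ ϖ (α−1) (β−1) m* d M₀ (D·u) ↔ normSign σ (u₀·D₀(π₀^{k₁}e_B − π₀^{k₃}e_C) + u₁·D₁N(x)·π₀^{k₁}e_B) = 1` — the letter of LH7-p06 (g0)'s tube head, with the
`e_B`-part now the unit LEADING TERM (★ Gram cancellation is EXACT) and the `e_C`-part the twist of depth `2k₃ − 2ρ − s`. [cite: Kottwitz1986BaseChangeUnits, §1 pp. 240–241]
[cite: Rogawski1990, §4.9 Prop. 4.9.1 (a)(b) p. 55, §4.10 p. 58] [cite: LanglandsShelstad1987, §3] [cite: Serre1979, Ch. V §3 Cor. 3] [cite: Jacobowitz1962, §4, §7] -/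
theorem twoSlotLabel_latt_G3_foot (hD : IsRamifiedQuadraticDatum σ ϖ d t) (h2d : 2 ≤ d)
    (hE : IsElementDatum σ ϖ N₀ α β n₁ n₂ n₃) (hmc : mcOfRecord d ≤ N₀)
    (T : GL (Fin 3) K) (hT : (T : Matrix (Fin 3) (Fin 3) K) = Matrix.diagonal ![α, β, 1])
    {ρ s : ℕ} (hρ : 1 ≤ ρ) (hs : 1 ≤ s) {x y z : K} (hx : Valued.v x = 1) (hy : Valued.v y = 1) (hz : Valued.v z = Valued.v (ϖ ^ ρ))
    (k₃ : ℕ) (hlt : 2 * ρ + s < 2 * k₃) (hk₃ : 2 * k₃ + d % 2 = n₃) (k₁ : ℕ) (hk₁ : 2 * k₁ + d % 2 = n₁) (hfoot : 2 * ρ + d % 2 = n₁)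
    {M₀ : Submodule 𝒪[K] (Fin 3 → K)} (hM₀ : M₀ = latt (!![1, 0, 0; x, ϖ ^ (ρ + s), 0; y, z, ϖ ^ (2 * ρ)] : Matrix (Fin 3) (Fin 3) K))
    (hTM : mapGL T M₀ = M₀) {D : Fin 3 → K} (hD₁ : ∀ j, σ (D j) = D j ∧ D j ≠ 0) (hV₁ : IsVertexLattice σ ϖ (Matrix.diagonal D) 0 M₀)
    (hlev : LatticeInLevel ϖ (d % 2) (Matrix.diagonal ![α - 1, β - 1, 0]) M₀) (hnlev : ¬ LatticeInLevel ϖ (d % 2 + 1) (Matrix.diagonal ![α - 1, β - 1, 0]) M₀)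
    (hsq : LatticeInLevel ϖ (mcOfRecord d) (Matrix.diagonal ![(α - 1) * (α - 1), (β - 1) * (β - 1), 0]) M₀)
    {eC : K} (hσeC : σ eC = eC)
    (heC : Valued.v ((ϖ ^ (d % 2 + 2 * d - 1))⁻¹ * ((β - α) * ((ϖ * σ ϖ) ^ k₃)⁻¹ - eC * ((ϖ - σ ϖ) * ((ϖ * σ ϖ) ^ ((d - d % 2) / 2))⁻¹))) ≤ 1)
    {eB : K} (hσeB : σ eB = eB)
    (heB : Valued.v ((ϖ ^ (d % 2 + 2 * d - 1))⁻¹ * ((β - 1) * ((ϖ * σ ϖ) ^ k₁)⁻¹ - eB * ((ϖ - σ ϖ) * ((ϖ * σ ϖ) ^ ((d - d % 2) / 2))⁻¹))) ≤ 1) :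
    ∀ u ∈ fixedUnitStabilizer σ M₀,
      valueClassLabel σ ϖ (α - 1) (β - 1) (d % 2 + 2 * d - 1) d M₀ (fun k => D k * ((u k : Kˣ) : K)) ↔
        normSign σ (((u 0 : Kˣ) : K) * (D 0 * ((ϖ * σ ϖ) ^ k₁ * eB - (ϖ * σ ϖ) ^ k₃ * eC)) +
            ((u 1 : Kˣ) : K) * (D 1 * (σ x * x) * ((ϖ * σ ϖ) ^ k₁ * eB))) = 1 := by
  have hD' := hD
  obtain ⟨hσ, hvσ, hϖ, -, -, -, -⟩ := hD'
  haveI : IsAdicComplete 𝓂[K] 𝒪[K] := isAdicComplete_valuedInteger_of_completeSpace hϖ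
  have hϖ0 : ϖ ≠ 0 := fun h0 => by rw [h0, map_zero] at hϖ; exact WithZero.coe_ne_zero hϖ.symm
  have hϖ1 : Valued.v ϖ ≤ 1 := by rw [hϖ, ← WithZero.exp_zero, WithZero.exp_le_exp]; norm_num
  have hσϖ0 : σ ϖ ≠ 0 := (map_ne_zero σ).2 hϖ0
  have hπ₀σ : σ (ϖ * σ ϖ) = ϖ * σ ϖ := by rw [map_mul, hσ, mul_comm]
  have hπσ : ∀ k : ℕ, σ ((ϖ * σ ϖ) ^ k) = (ϖ * σ ϖ) ^ k := fun k => by rw [map_pow, hπ₀σ]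
  have hπne : ∀ k : ℕ, ((ϖ * σ ϖ) ^ k : K) ≠ 0 := fun k => pow_ne_zero _ (mul_ne_zero hϖ0 hσϖ0)
  have hvπ : ∀ k : ℕ, Valued.v ((ϖ * σ ϖ) ^ k) = WithZero.exp (-((2 * k : ℕ) : ℤ)) := fun k => by
    rw [map_pow, map_mul, hvσ, ← pow_two, ← pow_mul, v_varpi_pow hϖ]
  have hα : Valued.v (α - 1) = Valued.v ϖ ^ n₂ := hE.2.2.2.2.2.2.1
  have hβ : Valued.v (β - 1) = Valued.v ϖ ^ n₁ := hE.2.2.2.2.2.1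
  have hγ : Valued.v (α - β) = Valued.v ϖ ^ n₃ := hE.2.2.2.2.2.2.2.1
  have hN₁ : N₀ ≤ n₁ := hE.2.2.2.2.2.2.2.2.1
  have hN₂ : N₀ ≤ n₂ := hE.2.2.2.2.2.2.2.2.2.1
  have hN₃ : N₀ ≤ n₃ := hE.2.2.2.2.2.2.2.2.2.2
  have hmcv : mcOfRecord d = 2 * ((d % 2 + 2 * d - 1 + d) / 2) := rfl
  have hq : ∀ n : ℕ, Valued.v (ϖ ^ n) = WithZero.exp (-(n : ℤ)) := fun n => by rw [map_pow, v_varpi_pow hϖ]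
  -- ★ p861251: polarisation valuations, EXACT Gram cancellation, normalisation, fibre, stabiliser tube
  have hV₁' := hV₁
  rw [hM₀] at hV₁'
  obtain ⟨hvD0, hvD1, -⟩ := v_polarisation_latt_G3 hvσ hϖ (fun k => (hD₁ k).2) hρ hs hx hy hz hV₁'
  have hgram := v_gram_cancel_latt_G3_eq hvσ hϖ (fun k => (hD₁ k).2) hρ hs hx hy hz hV₁'
  have hzle : Valued.v z ≤ 1 := by rw [hz, hq, ← WithZero.exp_zero, WithZero.exp_le_exp]; omega
  have hnorm := isNormalisedLattice_latt_G3 hϖ1 hx hy hzle ρ s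
  rw [← hM₀] at hnorm
  have hcoset := fibre_isCoset_zero hvσ ϖ (Matrix.GeneralLinearGroup.mkOfDetNeZero _ (det_latt_G3_ne_zero hϖ0 x y z ρ s)) hM₀ hnorm _ hD₁ hV₁
  have hSF : ∀ u ∈ fixedUnitStabilizer σ M₀, Valued.v (((u 1 : Kˣ) : K) - (u 0 : Kˣ)) ≤ Valued.v (ϖ ^ (ρ + s)) := fun u hu => by
    rw [hM₀] at hu
    exact (v_sub_le_of_mem_fixedUnitStabilizer_latt_G3 σ hϖ0 hϖ1 hx hz hu).1
  have hform : (!![1, 0, 0; x, ϖ ^ (ρ + s), 0; y, z, ϖ ^ (2 * ρ)] : Matrix (Fin 3) (Fin 3) K) =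
      Matrix.of ![![1, 0, 0], ![x, ϖ ^ (ρ + s), 0], ![y, z, ϖ ^ (2 * ρ)]] := rfl
  -- `|D₀·π₀^{k₃}| < 1` (below the read), `|N(x)| = 1`
  have hD0π : Valued.v (D 0 * (ϖ * σ ϖ) ^ k₃) ≤ 1 := by
    rw [map_mul, hvD0, hvπ, ← WithZero.exp_add, ← WithZero.exp_zero, WithZero.exp_le_exp]; push_cast; omega
  have hNx : Valued.v (σ x * x) = 1 := by rw [map_mul, hvσ, hx, one_mul]
  intro u hu
  have h10 : Valued.v (((u 1 : Kˣ) : K) - (u 0 : Kˣ)) ≤ Valued.v (ϖ ^ (ρ + s)) := hSF u hu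
  obtain ⟨huv, huσ⟩ := (mem_fixedUnitTorus_iff σ u).1 (Subgroup.mem_inf.1 (show u ∈ fixedUnitStabilizer σ M₀ from hu)).2
  have hDuσ : ∀ k, σ (D k * ((u k : Kˣ) : K)) = D k * ((u k : Kˣ) : K) := fun k => by rw [map_mul, (hD₁ k).1, huσ k]
  have hDu0 : ∀ k, D k * ((u k : Kˣ) : K) ≠ 0 := fun k => mul_ne_zero (hD₁ k).2 (u k).ne_zero
  have hVu : IsVertexLattice σ ϖ (Matrix.diagonal fun k => D k * ((u k : Kˣ) : K)) 0 M₀ := (hcoset _ fun k => ⟨hDuσ k, hDu0 k⟩).2 ⟨u, hu, fun k => rfl⟩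
  -- the bracket `B(u) = u₀(D₀ + σx·D₁·x) + (u₁−u₀)·D₁N(x)`, `|B(u)| = exp 2ρ` EXACTLY at the foot
  set B : K := ((u 0 : Kˣ) : K) * (D 0 + σ x * D 1 * x) + (((u 1 : Kˣ) : K) - (u 0 : Kˣ)) * (D 1 * (σ x * x)) with hBdef
  have hB1 : Valued.v (((u 0 : Kˣ) : K) * (D 0 + σ x * D 1 * x)) = WithZero.exp ((2 * ρ : ℕ) : ℤ) := by rw [map_mul, huv 0, one_mul, hgram]
  have hB2 : Valued.v ((((u 1 : Kˣ) : K) - (u 0 : Kˣ)) * (D 1 * (σ x * x))) < WithZero.exp ((2 * ρ : ℕ) : ℤ) := by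
    rw [map_mul, map_mul, hvD1, hNx, mul_one]
    calc Valued.v (((u 1 : Kˣ) : K) - (u 0 : Kˣ)) * WithZero.exp ((2 * ρ + s : ℕ) : ℤ)
        ≤ Valued.v (ϖ ^ (ρ + s)) * WithZero.exp ((2 * ρ + s : ℕ) : ℤ) := by gcongr
      _ < WithZero.exp ((2 * ρ : ℕ) : ℤ) := by rw [hq, ← WithZero.exp_add, WithZero.exp_lt_exp]; push_cast; omega
  have hB : Valued.v B = WithZero.exp ((2 * ρ : ℕ) : ℤ) := by
    rw [hBdef, Valuation.map_add_eq_of_lt_left _ (by rw [hB1]; exact hB2), hB1]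
  -- the top value `A(u) = B(u)·(β−1) + (−D₀u₀(β−α))`: at the foot the bracket LEADS (`|B(β−1)| = |ϖ|^{ℓ₀}`) and the `e_C` term is the twist
  have hS : D 0 * ((u 0 : Kˣ) : K) * (α - 1) + D 1 * ((u 1 : Kˣ) : K) * σ x * ((β - 1) * x) =
      B * (β - 1) + -(D 0 * ((u 0 : Kˣ) : K) * (β - α)) := by rw [hBdef]; ring
  have hmain : Valued.v (B * (β - 1)) = Valued.v (ϖ ^ (d % 2)) := by
    rw [map_mul, hB, hβ, v_varpi_pow hϖ, ← WithZero.exp_add, hq]; congr 1; push_cast; omega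
  have htwist : Valued.v (-(D 0 * ((u 0 : Kˣ) : K) * (β - α))) < Valued.v (ϖ ^ (d % 2)) := by
    rw [Valuation.map_neg, map_mul, map_mul, hvD0, huv 0, mul_one, Valuation.map_sub_swap, hγ, v_varpi_pow hϖ, ← WithZero.exp_add, hq, WithZero.exp_lt_exp]
    push_cast; omega
  have hA : Valued.v (D 0 * ((u 0 : Kˣ) : K) * (α - 1) + D 1 * ((u 1 : Kˣ) : K) * σ x * ((β - 1) * x)) = Valued.v (ϖ ^ (d % 2)) := by
    rw [hS, Valuation.map_add_eq_of_lt_left _ (by rw [hmain]; exact htwist), hmain]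
  -- the congruence `A(u) ≡ G(u)·t₊ (mod ϖ^{m*})` with `G(u) = B(u)·π₀^{k₁}e_B − D₀u₀·π₀^{k₃}e_C`
  set G : K := ((u 0 : Kˣ) : K) * (D 0 * ((ϖ * σ ϖ) ^ k₁ * eB - (ϖ * σ ϖ) ^ k₃ * eC)) +
    ((u 1 : Kˣ) : K) * (D 1 * (σ x * x) * ((ϖ * σ ϖ) ^ k₁ * eB)) with hGdef
  have hGB : G = -(D 0 * ((u 0 : Kˣ) : K) * eC) * (ϖ * σ ϖ) ^ k₃ + B * ((ϖ * σ ϖ) ^ k₁ * eB) := by rw [hGdef, hBdef]; ring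
  have hkey : (ϖ ^ (d % 2 + 2 * d - 1))⁻¹ * ((D 0 * ((u 0 : Kˣ) : K) * (α - 1) + D 1 * ((u 1 : Kˣ) : K) * σ x * ((β - 1) * x)) -
      G * ((ϖ - σ ϖ) * ((ϖ * σ ϖ) ^ ((d - d % 2) / 2))⁻¹)) =
      -(D 0 * (ϖ * σ ϖ) ^ k₃ * ((u 0 : Kˣ) : K)) *
          ((ϖ ^ (d % 2 + 2 * d - 1))⁻¹ * ((β - α) * ((ϖ * σ ϖ) ^ k₃)⁻¹ - eC * ((ϖ - σ ϖ) * ((ϖ * σ ϖ) ^ ((d - d % 2) / 2))⁻¹))) +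
        B * (ϖ * σ ϖ) ^ k₁ *
          ((ϖ ^ (d % 2 + 2 * d - 1))⁻¹ * ((β - 1) * ((ϖ * σ ϖ) ^ k₁)⁻¹ - eB * ((ϖ - σ ϖ) * ((ϖ * σ ϖ) ^ ((d - d % 2) / 2))⁻¹))) := by
    rw [hS, hGB]
    have h3 : (ϖ * σ ϖ) ^ k₃ * ((ϖ * σ ϖ) ^ k₃)⁻¹ = (1 : K) := mul_inv_cancel₀ (hπne k₃)
    have h1 : (ϖ * σ ϖ) ^ k₁ * ((ϖ * σ ϖ) ^ k₁)⁻¹ = (1 : K) := mul_inv_cancel₀ (hπne k₁)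
    linear_combination (D 0 * ((u 0 : Kˣ) : K) * (ϖ ^ (d % 2 + 2 * d - 1))⁻¹ * (β - α)) * h3 -
      (B * (ϖ ^ (d % 2 + 2 * d - 1))⁻¹ * (β - 1)) * h1
  have hG : Valued.v ((ϖ ^ (d % 2 + 2 * d - 1))⁻¹ * ((D 0 * ((u 0 : Kˣ) : K) * (α - 1) + D 1 * ((u 1 : Kˣ) : K) * σ x * ((β - 1) * x)) -
      G * ((ϖ - σ ϖ) * ((ϖ * σ ϖ) ^ ((d - d % 2) / 2))⁻¹))) ≤ 1 := by
    rw [hkey]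
    refine (Valuation.map_add _ _ _).trans (max_le ?_ ?_)
    · rw [map_mul, Valuation.map_neg, map_mul, huv 0, mul_one]
      exact mul_le_one' hD0π heC
    · rw [map_mul, map_mul, hvπ, hB]
      calc WithZero.exp ((2 * ρ : ℕ) : ℤ) * WithZero.exp (-((2 * k₁ : ℕ) : ℤ)) * Valued.v ((ϖ ^ (d % 2 + 2 * d - 1))⁻¹ *
              ((β - 1) * ((ϖ * σ ϖ) ^ k₁)⁻¹ - eB * ((ϖ - σ ϖ) * ((ϖ * σ ϖ) ^ ((d - d % 2) / 2))⁻¹)))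
          ≤ WithZero.exp ((2 * ρ : ℕ) : ℤ) * WithZero.exp (-((2 * k₁ : ℕ) : ℤ)) * 1 := by gcongr
        _ ≤ 1 := by rw [mul_one, ← WithZero.exp_add, ← WithZero.exp_zero, WithZero.exp_le_exp]; push_cast; omega
  have hσG : σ G = G := by
    rw [hGdef]
    simp only [map_add, map_sub, map_mul, hπσ, huσ, (hD₁ 0).1, (hD₁ 1).1, hσeB, hσeC, hσ]
    ring
  have hread := valueClassLabel_latt_hnf_iff_normSign hD hDuσ hDu0 (b := ρ + s) (c := 2 * ρ) hx.le hy.le hzle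
    (by rw [← hform, ← hM₀]; exact hnorm) (by rw [← hform, ← hM₀]; exact hVu) hE (mc := mcOfRecord d)
    (by omega) (by omega) (by rw [hmcv]; omega) (by rw [hmcv]; omega)
    (by rw [← hform, ← hM₀]; exact hlev) (by rw [← hform, ← hM₀]; exact hnlev) (by rw [← hform, ← hM₀]; exact hsq) hT (by rw [← hform, ← hM₀]; exact hTM) hA hσG hG
  rw [← hform, ← hM₀] at hread
  exact hread

/-! ## §2  The foot letters for the class sum (no label) -/

omit [CompleteSpace K] in
/-- **THE LEADING COEFFICIENT IS A UNIT AT THE FOOT**: on the G₃ normal form with polarisation `D`, for every `u ∈ S_F(M₀)`, `|u₀·D₀ + u₁·D₁N(x)| = exp 2ρ` EXACTLY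
(`u₀D₀ + u₁D₁N(x) = u₀(D₀ + σxD₁x) + (u₁−u₀)D₁N(x)`; ★ `v_gram_cancel_latt_G3_eq` gives `exp 2ρ` for the first term, the stabiliser tube `|u₁−u₀| ≤ |ϖ|^{ρ+s}` makes the second
`≤ exp ρ < exp 2ρ`).  Hence `|(u₀D₀ + u₁D₁N(x))·π₀^{k₁}·e_B| = 1` at the foot `2k₁ = 2ρ`. [cite: Jacobowitz1962, §4, §7] [cite: Kottwitz1986BaseChangeUnits, §1 pp. 240–241] -/
theorem v_leading_latt_G3_foot (hD : IsRamifiedQuadraticDatum σ ϖ d t)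
    {ρ s : ℕ} (hρ : 1 ≤ ρ) (hs : 1 ≤ s) {x y z : K} (hx : Valued.v x = 1) (hy : Valued.v y = 1) (hz : Valued.v z = Valued.v (ϖ ^ ρ))
    {M₀ : Submodule 𝒪[K] (Fin 3 → K)} (hM₀ : M₀ = latt (!![1, 0, 0; x, ϖ ^ (ρ + s), 0; y, z, ϖ ^ (2 * ρ)] : Matrix (Fin 3) (Fin 3) K))
    {D : Fin 3 → K} (hD₁ : ∀ j, σ (D j) = D j ∧ D j ≠ 0) (hV₁ : IsVertexLattice σ ϖ (Matrix.diagonal D) 0 M₀)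
    {u : Fin 3 → Kˣ} (hu : u ∈ fixedUnitStabilizer σ M₀) :
    Valued.v (((u 0 : Kˣ) : K) * D 0 + ((u 1 : Kˣ) : K) * (D 1 * (σ x * x))) = WithZero.exp ((2 * ρ : ℕ) : ℤ) := by
  have hD' := hD
  obtain ⟨-, hvσ, hϖ, -, -, -, -⟩ := hD'
  have hϖ0 : ϖ ≠ 0 := fun h0 => by rw [h0, map_zero] at hϖ; exact WithZero.coe_ne_zero hϖ.symm
  have hϖ1 : Valued.v ϖ ≤ 1 := by rw [hϖ, ← WithZero.exp_zero, WithZero.exp_le_exp]; norm_num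
  have hq : ∀ n : ℕ, Valued.v (ϖ ^ n) = WithZero.exp (-(n : ℤ)) := fun n => by rw [map_pow, v_varpi_pow hϖ]
  have hV₁' := hV₁
  rw [hM₀] at hV₁'
  obtain ⟨-, hvD1, -⟩ := v_polarisation_latt_G3 hvσ hϖ (fun k => (hD₁ k).2) hρ hs hx hy hz hV₁'
  have hgram := v_gram_cancel_latt_G3_eq hvσ hϖ (fun k => (hD₁ k).2) hρ hs hx hy hz hV₁'
  have hu' := hu
  rw [hM₀] at hu'
  have h10 := (v_sub_le_of_mem_fixedUnitStabilizer_latt_G3 σ hϖ0 hϖ1 hx hz hu').1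
  obtain ⟨huv, -⟩ := (mem_fixedUnitTorus_iff σ u).1 (Subgroup.mem_inf.1 (show u ∈ fixedUnitStabilizer σ M₀ from hu)).2
  have hNx : Valued.v (σ x * x) = 1 := by rw [map_mul, hvσ, hx, one_mul]
  have hB1 : Valued.v (((u 0 : Kˣ) : K) * (D 0 + σ x * D 1 * x)) = WithZero.exp ((2 * ρ : ℕ) : ℤ) := by rw [map_mul, huv 0, one_mul, hgram]
  have hB2 : Valued.v ((((u 1 : Kˣ) : K) - (u 0 : Kˣ)) * (D 1 * (σ x * x))) < WithZero.exp ((2 * ρ : ℕ) : ℤ) := by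
    rw [map_mul, map_mul, hvD1, hNx, mul_one]
    calc Valued.v (((u 1 : Kˣ) : K) - (u 0 : Kˣ)) * WithZero.exp ((2 * ρ + s : ℕ) : ℤ)
        ≤ Valued.v (ϖ ^ (ρ + s)) * WithZero.exp ((2 * ρ + s : ℕ) : ℤ) := by gcongr
      _ < WithZero.exp ((2 * ρ : ℕ) : ℤ) := by rw [hq, ← WithZero.exp_add, WithZero.exp_lt_exp]; push_cast; omega
  rw [show ((u 0 : Kˣ) : K) * D 0 + ((u 1 : Kˣ) : K) * (D 1 * (σ x * x)) =
      ((u 0 : Kˣ) : K) * (D 0 + σ x * D 1 * x) + (((u 1 : Kˣ) : K) - (u 0 : Kˣ)) * (D 1 * (σ x * x)) by ring,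
    Valuation.map_add_eq_of_lt_left _ (by rw [hB1]; exact hB2), hB1]

omit [CompleteSpace K] in
/-- **THE `(0,0)` GRAM ENTRY SPLITS THE GRAM UNIT**: on the G₃ normal form with polarisation `D` (`|D₂| = exp 2ρ`, ★ `v_polarisation_latt_G3`) there is `g₀₀` with `|g₀₀| ≤ 1` and
`D₀ + σx·D₁·x = g₀₀ − σy·D₂·y`, `|σy·D₂·y| = exp 2ρ` (★ `gram_values`: the HNF generator `(1, x, y)` has integral self-pairing `g₀₀ = D₀ + σxD₁x + σyD₂y`).  At conductor depth
`2ρ ≥ 2d − 1` this reads `ω(D₀ + σxD₁x) = ω(−D₂·N(y)) = ω(−D₂)` — the OWN slot's door. [cite: Jacobowitz1962, §4, §7] [cite: Kottwitz1986BaseChangeUnits, §1 pp. 240–241] -/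
theorem gram00_latt_G3 (hD : IsRamifiedQuadraticDatum σ ϖ d t)
    {ρ s : ℕ} (hρ : 1 ≤ ρ) (hs : 1 ≤ s) {x y z : K} (hx : Valued.v x = 1) (hy : Valued.v y = 1) (hz : Valued.v z = Valued.v (ϖ ^ ρ))
    {M₀ : Submodule 𝒪[K] (Fin 3 → K)} (hM₀ : M₀ = latt (!![1, 0, 0; x, ϖ ^ (ρ + s), 0; y, z, ϖ ^ (2 * ρ)] : Matrix (Fin 3) (Fin 3) K))
    {D : Fin 3 → K} (hD₁ : ∀ j, σ (D j) = D j ∧ D j ≠ 0) (hV₁ : IsVertexLattice σ ϖ (Matrix.diagonal D) 0 M₀) :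
    ∃ g₀₀ : K, Valued.v g₀₀ ≤ 1 ∧ σ g₀₀ = g₀₀ ∧ D 0 + σ x * D 1 * x = g₀₀ - σ y * D 2 * y ∧
      Valued.v (σ y * D 2 * y) = WithZero.exp ((2 * ρ : ℕ) : ℤ) := by
  have hD' := hD
  obtain ⟨hσ, hvσ, hϖ, -, -, -, -⟩ := hD'
  have hϖ0 : ϖ ≠ 0 := fun h0 => by rw [h0, map_zero] at hϖ; exact WithZero.coe_ne_zero hϖ.symm
  have hV₁' := hV₁
  rw [hM₀] at hV₁'
  obtain ⟨-, -, hvD2⟩ := v_polarisation_latt_G3 hvσ hϖ (fun k => (hD₁ k).2) hρ hs hx hy hz hV₁'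
  have hform : (!![1, 0, 0; x, ϖ ^ (ρ + s), 0; y, z, ϖ ^ (2 * ρ)] : Matrix (Fin 3) (Fin 3) K) =
      Matrix.of ![![1, 0, 0], ![x, ϖ ^ (ρ + s), 0], ![y, z, ϖ ^ (2 * ρ)]] := rfl
  rw [hform] at hV₁'
  obtain ⟨-, hG00, -⟩ := gram_values hvσ hϖ0 D (ρ + s) (2 * ρ) x y z hV₁'
  refine ⟨D 0 + σ x * D 1 * x + σ y * D 2 * y, hG00, ?_, by ring, by rw [map_mul, map_mul, hvσ, hy, hvD2, one_mul, mul_one]⟩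
  rw [map_add, map_add, map_mul, map_mul, map_mul, map_mul, hσ, hσ, (hD₁ 0).1, (hD₁ 1).1, (hD₁ 2).1]
  ring

omit [CompleteSpace K] in
/-- **THE OWN-SLOT TUBE ON `S_F`** (★ p861251, re-exported in the letters of the class sum): on the G₃ normal form every `u ∈ S_F(M₀)` has `|u₂ − u₀| ≤ |ϖ^ρ|` and `|u₁ − u₀| ≤ |ϖ^{ρ+s}|`
— so `ω(u₀u₂) = ω(1 + (u₂−u₀)∕u₀)` is a character of conductor depth `ρ` on the class transversal. [cite: Kottwitz1986BaseChangeUnits, §1 pp. 240–241] -/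
theorem v_sub_two_zero_le_of_mem_fixedUnitStabilizer_latt_G3 (hD : IsRamifiedQuadraticDatum σ ϖ d t)
    {ρ s : ℕ} {x y z : K} (hx : Valued.v x = 1) (hz : Valued.v z = Valued.v (ϖ ^ ρ))
    {M₀ : Submodule 𝒪[K] (Fin 3 → K)} (hM₀ : M₀ = latt (!![1, 0, 0; x, ϖ ^ (ρ + s), 0; y, z, ϖ ^ (2 * ρ)] : Matrix (Fin 3) (Fin 3) K))
    {u : Fin 3 → Kˣ} (hu : u ∈ fixedUnitStabilizer σ M₀) :
    Valued.v (((u 2 : Kˣ) : K) - (u 0 : Kˣ)) ≤ Valued.v (ϖ ^ ρ) ∧ Valued.v (((u 1 : Kˣ) : K) - (u 0 : Kˣ)) ≤ Valued.v (ϖ ^ (ρ + s)) := by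
  have hD' := hD
  obtain ⟨-, -, hϖ, -, -, -, -⟩ := hD'
  have hϖ0 : ϖ ≠ 0 := fun h0 => by rw [h0, map_zero] at hϖ; exact WithZero.coe_ne_zero hϖ.symm
  have hϖ1 : Valued.v ϖ ≤ 1 := by rw [hϖ, ← WithZero.exp_zero, WithZero.exp_le_exp]; norm_num
  rw [hM₀] at hu
  obtain ⟨h1, -, h3⟩ := v_sub_le_of_mem_fixedUnitStabilizer_latt_G3 σ hϖ0 hϖ1 hx hz hu
  exact ⟨h3, h1⟩

end Summit.HodgeConjecture.HodgeConjecture.Cruxes.H413.F0P3cDyRamLabelledOddKappaClassLatticeG3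

end
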